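import Literature.Analysis.TotalPositivity.PolyaFrequencyFiniteProduct
import Literature.Analysis.TotalPositivity.PolyaFrequencyInfiniteProduct
import HarnessLib

/-!
# Schoenberg 1951, sufficiency half: every function of Schoenberg's form (7) is the reciprocal
Laplace transform of a Pólya frequency function

Trunk `Literature/Analysis/TotalPositivity`, seventh proofs file accompanying
`PolyaFrequencyFunctions.lean` (the named fact `schoenberg1951_pf_laplace`): the assembly of the
sufficiency half `(⇐)` of the fact,

> for every `Ψ` with `HasSchoenbergForm Ψ` there are a Pólya frequency function `Λ` and a strip
> `a < 0 < b` on which the bilateral Laplace transform of `Λ` converges absolutely to `1/Ψ`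

(`schoenberg1951_pf_laplace_mpr`).  Finitely supported `δ_ν`: `exists_pf_of_schoenbergForm_finite`
(PolyaFrequencyFiniteProduct.lean).  Infinitely many `δ_ν ≠ 0`: the continuous finite
convolutions `Λ_N` of PolyaFrequencyFiniteProduct.lean (Gaussian of parameter `γ + 1/(N+1)`
convolved with `Λ_{δ_ν}`, `ν < N`) feed the abstract limit theorem `exists_pf_of_approx`
(PolyaFrequencyInfiniteProduct.lean); the shift `e^{δs}` and the constant `C` are put back by the
affine closure lemmas.  The necessity half `(⇒)` of `schoenberg1951_pf_laplace` is NOT proved in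
the tree yet.

## References

* I. J. Schoenberg, *On Pólya frequency functions. I. The totally positive functions and their
  Laplace transforms*, J. Analyse Math. 1 (1951) 331–374, Thm. 1 (sufficiency part).
  [Schoenberg1951]
* I. J. Schoenberg, A. Whitney, *On Pólya frequency functions. III*, Trans. AMS 74 (1953)
  246–259, Introduction pp. 246–247, (3)–(7). [SchoenbergWhitney1953]
* S. Karlin, *Total Positivity* I (1968), Ch. 7, Thm. 3.2 (sufficiency). [Karlin1968]
-/

noncomputable section

open MeasureTheory Set Filter
open scoped Topology

namespace Literature.Analysis.TotalPositivity

/-- **Schoenberg 1951, Theorem 1 (sufficiency half of `schoenberg1951_pf_laplace`).**  Every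
entire function of Schoenberg's form (7),
`Ψ(s) = C e^{−γs² + δs} ∏ (1 + δ_ν s) e^{−δ_ν s}` (`C > 0`, `γ ≥ 0`, `δ, δ_ν ∈ ℝ`,
`0 < γ + Σδ_ν² < ∞`), is the reciprocal of the bilateral Laplace transform of a Pólya frequency
function on a strip `a < Re s < b`, `a < 0 < b` (the transform converging absolutely there):
"the most general Pólya frequency function is obtained … by convoluting the normal function with a
finite or infinite sequence of one-sided exponentials", read as an existence statement.
[cite: Schoenberg1951, Thm. 1 (sufficiency)]
[cite: SchoenbergWhitney1953, Introduction pp. 246–247, (3)–(7)] -/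
theorem schoenberg1951_pf_laplace_mpr (Ψ : ℂ → ℂ) (hΨ : HasSchoenbergForm Ψ) :
    ∃ (Λ : ℝ → ℝ) (a b : ℝ), a < 0 ∧ 0 < b ∧ IsPolyaFrequencyFun Λ ∧
      HasLaplaceTransformInvOn Λ Ψ a b := by
  obtain ⟨C, γ, δ, d, hC, hγ, hd, hpos, hΨ⟩ := hΨ
  by_cases hfin : ∃ N : ℕ, ∀ ν, N ≤ ν → d ν = 0
  · obtain ⟨N, hN⟩ := hfin
    exact exists_pf_of_schoenbergForm_finite hC hγ hN hpos hΨ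
  · push Not at hfin
    obtain ⟨ν₁, -, hν₁⟩ := hfin 0
    obtain ⟨ν₂, hν₂, hν₂'⟩ := hfin (ν₁ + 1)
    have hne : ν₁ ≠ ν₂ := by omega
    obtain ⟨ρ, hρ, hρd⟩ := exists_rho_of_summable_sq hd
    -- the approximating family: Gaussian of parameter `γ + 1/(N+1)` convolved with the `Λ_{d_ν}`
    set ε : ℕ → ℝ := fun N => 1 / ((N : ℝ) + 1) with hεdef
    have hε0 : ∀ N, 0 ≤ ε N := fun N => by positivity
    have hε1 : ∀ N, ε N ≤ 1 := fun N => by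
      rw [hεdef]
      simp only
      rw [div_le_one (by positivity)]
      linarith [(N.cast_nonneg : (0 : ℝ) ≤ N)]
    have hε : Tendsto ε atTop (𝓝 0) := tendsto_one_div_add_atTop_nhds_zero_nat
    have hfam : ∀ N : ℕ, ∃ Λ : ℝ → ℝ, IsPolyaFrequencyFun Λ ∧ (∃ B, ∀ u, Λ u ≤ B) ∧
        HasLaplaceTransformInvOn Λ (fun s => ((1 : ℝ) : ℂ) *
          Complex.exp (-((γ + ε N : ℝ) : ℂ) * s ^ 2 + ((0 : ℝ) : ℂ) * s) *
            ∏ ν ∈ Finset.range N, ((1 + (d ν : ℂ) * s) * Complex.exp (-((d ν : ℂ) * s))))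
          (-ρ) ρ ∧ Continuous Λ := fun N =>
      exists_pf_finiteProduct_gauss one_pos (by have := hε0 N; positivity) 0 d hρ hρd N
    choose Λs hPF hB hLap hcont using hfam
    have hLap' : ∀ N, HasLaplaceTransformInvOn (Λs N)
        (fun s => Complex.exp (-((γ + ε N : ℝ) : ℂ) * s ^ 2) *
          ∏ ν ∈ Finset.range N, ((1 + (d ν : ℂ) * s) * Complex.exp (-((d ν : ℂ) * s))))
        (-ρ) ρ := fun N =>
      (hLap N).congr rfl fun s _ _ => by
        simp only [Complex.ofReal_one, one_mul, Complex.ofReal_zero, zero_mul, add_zero]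
    obtain ⟨Λ₀, hΛ₀, hΨ₀⟩ :=
      exists_pf_of_approx hγ hd hρ hρd hne hν₁ hν₂' hε0 hε1 hPF hcont hLap' hε
    -- put back the shift `e^{δs}` and the constant `C`
    refine ⟨fun u => C⁻¹ * Λ₀ (u + -δ), -ρ, ρ, by linarith, hρ,
      (hΛ₀.comp_add (-δ)).const_mul (inv_pos.2 hC), ?_⟩
    refine ((hΨ₀.comp_add (-δ)).const_mul (inv_ne_zero hC.ne')).congr rfl fun s _ _ => ?_
    rw [hΨ s]
    push_cast
    rw [inv_inv, Complex.exp_add]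
    simp only [neg_neg, neg_mul]
    ring

end Literature.Analysis.TotalPositivity

end
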